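import Summits.AnomalousDissipation.AnomalousDissipation.Theorems.TwoAndHalfDScalarLift2halfDRTraceSteady
import Summits.AnomalousDissipation.AnomalousDissipation.Theorems.TwoAndHalfDScalarLift2halfDRGlueTools

/-!
# The weak `L²` trace of a weak sourced passive scalar at almost every time (space–time tests)

Summit-side helper file (everything proved) for the `2½`-dimensional scalar lift
(`Summit.AnomalousDissipation.AnomalousDissipation.Theses.TwoAndHalfD.ScalarLift2halfDR`), second
half: for a weak sourced scalar `θ` on `T^d × [0, T)` (`Torus.IsWeakScalarTransportForcedOn`),
for almost every `σ ∈ (0, T)` the slice `θ σ` is in `L²` and satisfies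

  `∫ θ(σ) ψ(σ) = ∫ θ₀ ψ(0) + ∫_{(0,σ]} ( ∫ θ (∂ₜψ + u·∇ψ + κΔψ) + ∫ s ψ )`

simultaneously for EVERY smooth space–time `ψ` (`ae_forall_traceIdentity'`) — the boundary term
needed to glue weak scalar solutions at the time `σ`. For a fixed test the identity holds a.e.
in time (weak formulation tested with `η(t)ψ(t,x)` and the du Bois-Reymond lemma with datum); at
a time that is good for all steady tests (`ae_forall_sliceIdentity`) it is upgraded by letting
`t → σ` along good times, the defect being controlled by the time-Lipschitz bound of `ψ` and the
steady identity for the slice `ψ(σ)`; a smooth time cutoff removes the support condition.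
-/

noncomputable section

open MeasureTheory Set Filter Topology Function UnitAddTorus Metric
open scoped ENNReal NNReal InnerProductSpace ContDiff
open Literature.Analysis.FunctionSpaces Literature.Analysis.FunctionSpaces.Torus
open Literature.Analysis.FluidPDE Literature.Analysis.FluidPDE.Torus

namespace Summit.AnomalousDissipation.AnomalousDissipation.Theorems

set_option linter.dupNamespace false

section Trace

variable {d : Type*} [Fintype d]
variable {T κ : ℝ} {u : ℝ → UnitAddTorus d → EuclideanSpace ℝ d} {s : ℝ → UnitAddTorus d → ℝ}
  {θ₀ : UnitAddTorus d → ℝ} {θ : ℝ → UnitAddTorus d → ℝ}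

/-! ### Space–time tests: the du Bois-Reymond identity and the trace at good times -/

/-- The product `θ ψ` of a weak sourced scalar with a space–time test function is integrable on
`(0,T) × T^d` (`θ ∈ L¹`, `ψ` bounded on `[0,T] × T^d`). [folklore] -/
theorem integrable_mul_test (h : IsWeakScalarTransportForcedOn T κ u s θ₀ θ)
    {ψ : ℝ → UnitAddTorus d → ℝ} (hψ : IsSpaceTimeTest T ψ) :
    Integrable (fun p : ℝ × UnitAddTorus d => θ p.1 p.2 * ψ p.1 p.2)
      (((volume : Measure ℝ).restrict (Ioo 0 T)).prod volume) := by
  have hψc : Continuous (uncurry ψ) := continuous_uncurry_of_continuous_stLift hψ.1.continuous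
  obtain ⟨C₀, hC₀⟩ := exists_bound_of_continuous_uncurry hψc 0 T
  refine Integrable.mono' (g := fun p : ℝ × UnitAddTorus d => C₀ * ‖uncurry θ p‖)
    (h.integrable_uncurry.norm.const_mul C₀)
    (h.aestronglyMeasurable_uncurry.mul hψc.aestronglyMeasurable) ?_
  filter_upwards [IsWeakScalarTransportForcedOn.ae_fst_mem_Ioo T] with p hp
  rw [norm_mul, mul_comm]
  exact mul_le_mul_of_nonneg_right (hC₀ p.1 (Ioo_subset_Icc_self hp) p.2) (norm_nonneg _)

/-- **The sourced weak formulation tested with `η(t) ψ(t, x)`** for a smooth compactly supported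
`η` and a space–time test function `ψ` on `[0, T)`:
`∫_{(0,T)} (η' ∫ θ ψ + η (∫ θ (∂ₜψ + u·∇ψ + κΔψ) + ∫ s ψ)) + η(0) ∫ θ₀ ψ(0) = 0`
(product rule in time, linearity of `∇`, `Δ` in the test; DiPerna–Lions 1989, (13)–(14) with a
time-dependent test). [folklore] -/
theorem setIntegral_test_smul_time (h : IsWeakScalarTransportForcedOn T κ u s θ₀ θ) {η : ℝ → ℝ}
    (hη : ContDiff ℝ ∞ η) (hηc : HasCompactSupport η)
    {ψ : ℝ → UnitAddTorus d → ℝ} (hψ : IsSpaceTimeTest T ψ) :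
    (∫ t in Ioo 0 T, ((deriv η t * ∫ x, θ t x * ψ t x) +
      η t * ((∫ x, θ t x * (Torus.timeDeriv ψ t x + ⟪u t x, Torus.gradient (ψ t) x⟫_ℝ +
        κ * Torus.laplacian (ψ t) x)) + ∫ x, s t x * ψ t x))) +
      η 0 * ∫ x, θ₀ x * ψ 0 x = 0 := by
  have hΨ : IsSpaceTimeTest T (fun t x => η t * ψ t x) := isSpaceTimeTest_smul_time hη hψ
  have key := h.integral_prod_weak_eq hΨ
  set P : Measure (ℝ × UnitAddTorus d) := ((volume : Measure ℝ).restrict (Ioo 0 T)).prod volume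
    with hP
  -- pointwise form of the two integrands
  have hpt : ∀ p : ℝ × UnitAddTorus d, θ p.1 p.2 *
      (Torus.timeDeriv (fun t x => η t * ψ t x) p.1 p.2 +
        ⟪u p.1 p.2, Torus.gradient ((fun t x => η t * ψ t x) p.1) p.2⟫_ℝ +
        κ * Torus.laplacian ((fun t x => η t * ψ t x) p.1) p.2) =
      deriv η p.1 * (θ p.1 p.2 * ψ p.1 p.2) +
        η p.1 * (θ p.1 p.2 * (Torus.timeDeriv ψ p.1 p.2 + ⟪u p.1 p.2, Torus.gradient (ψ p.1) p.2⟫_ℝ +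
          κ * Torus.laplacian (ψ p.1) p.2)) := by
    intro p
    have h1 : Torus.timeDeriv (fun t x => η t * ψ t x) p.1 p.2 =
        deriv η p.1 * ψ p.1 p.2 + η p.1 * Torus.timeDeriv ψ p.1 p.2 := by
      have := timeDeriv_smul' (hη.differentiable (by simp)) hψ.1 p.1 p.2
      simpa only [smul_eq_mul] using this
    rw [h1, gradient_const_mul ((hψ.isSmooth_slice p.1).isContDiff (by simp)) (η p.1),
      laplacian_const_mul (hψ.isSmooth_slice p.1) (η p.1), real_inner_smul_right]
    ring
  have hps : ∀ p : ℝ × UnitAddTorus d, s p.1 p.2 * (fun t x => η t * ψ t x) p.1 p.2 =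
      η p.1 * (s p.1 p.2 * ψ p.1 p.2) := fun p => by simp only; ring
  obtain ⟨Ca, hCa⟩ := (hη.continuous_deriv (by simp)).bounded_above_of_compact_support hηc.deriv
  obtain ⟨Cb, hCb⟩ := hη.continuous.bounded_above_of_compact_support hηc
  set f₁ : ℝ × UnitAddTorus d → ℝ := fun p => deriv η p.1 * (θ p.1 p.2 * ψ p.1 p.2) with hf₁
  set f₂ : ℝ × UnitAddTorus d → ℝ := fun p =>
    η p.1 * (θ p.1 p.2 * (Torus.timeDeriv ψ p.1 p.2 + ⟪u p.1 p.2, Torus.gradient (ψ p.1) p.2⟫_ℝ +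
      κ * Torus.laplacian (ψ p.1) p.2)) with hf₂
  set f₃ : ℝ × UnitAddTorus d → ℝ := fun p => η p.1 * (s p.1 p.2 * ψ p.1 p.2) with hf₃
  have hI₁ := integrable_mul_test h hψ
  have hI₂ := h.integrable_weakIntegrand hψ
  have hI₃ := h.integrable_source_mul_test hψ
  have hf₁i : Integrable f₁ P :=
    hI₁.bdd_mul ((hη.continuous_deriv (by simp)).comp continuous_fst).aestronglyMeasurable
      (Eventually.of_forall fun p => hCa p.1)
  have hf₂i : Integrable f₂ P :=
    hI₂.bdd_mul (hη.continuous.comp continuous_fst).aestronglyMeasurable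
      (Eventually.of_forall fun p => hCb p.1)
  have hf₃i : Integrable f₃ P :=
    hI₃.bdd_mul (hη.continuous.comp continuous_fst).aestronglyMeasurable
      (Eventually.of_forall fun p => hCb p.1)
  have esum : (∫ p, (f₁ p + f₂ p) ∂P) + (∫ p, f₃ p ∂P) + η 0 * ∫ x, θ₀ x * ψ 0 x = 0 := by
    have e1 : ∫ p, (f₁ p + f₂ p) ∂P = ∫ p, θ p.1 p.2 *
        (Torus.timeDeriv (fun t x => η t * ψ t x) p.1 p.2 +
          ⟪u p.1 p.2, Torus.gradient ((fun t x => η t * ψ t x) p.1) p.2⟫_ℝ +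
          κ * Torus.laplacian ((fun t x => η t * ψ t x) p.1) p.2) ∂P :=
      integral_congr_ae (Eventually.of_forall fun p => (hpt p).symm)
    have e2 : η 0 * ∫ x, θ₀ x * ψ 0 x = ∫ x, θ₀ x * (fun t x => η t * ψ t x) 0 x := by
      rw [← integral_const_mul]
      exact integral_congr_ae (Eventually.of_forall fun x => by simp only; ring)
    have e3 : ∫ p, f₃ p ∂P = ∫ p, s p.1 p.2 * (fun t x => η t * ψ t x) p.1 p.2 ∂P :=
      integral_congr_ae (Eventually.of_forall fun p => (hps p).symm)
    rw [e1, e2, e3]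
    exact key
  have e₁ : ∫ p, f₁ p ∂P = ∫ t in Ioo 0 T, deriv η t * ∫ x, θ t x * ψ t x := by
    rw [hP, integral_prod _ hf₁i]
    refine integral_congr_ae (Eventually.of_forall fun t => ?_)
    simp only [hf₁]
    exact integral_const_mul _ _
  have e₂ : ∫ p, f₂ p ∂P = ∫ t in Ioo 0 T, η t * ∫ x, θ t x *
      (Torus.timeDeriv ψ t x + ⟪u t x, Torus.gradient (ψ t) x⟫_ℝ + κ * Torus.laplacian (ψ t) x) := by
    rw [hP, integral_prod _ hf₂i]
    refine integral_congr_ae (Eventually.of_forall fun t => ?_)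
    simp only [hf₂]
    exact integral_const_mul _ _
  have e₃ : ∫ p, f₃ p ∂P = ∫ t in Ioo 0 T, η t * ∫ x, s t x * ψ t x := by
    rw [hP, integral_prod _ hf₃i]
    refine integral_congr_ae (Eventually.of_forall fun t => ?_)
    simp only [hf₃]
    exact integral_const_mul _ _
  have ha : Integrable (fun t => deriv η t * ∫ x, θ t x * ψ t x) (volume.restrict (Ioo 0 T)) := by
    refine hf₁i.integral_prod_left.congr (Eventually.of_forall fun t => ?_)
    simp only [hf₁]
    exact integral_const_mul _ _
  have hb : Integrable (fun t => η t * ∫ x, θ t x *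
      (Torus.timeDeriv ψ t x + ⟪u t x, Torus.gradient (ψ t) x⟫_ℝ + κ * Torus.laplacian (ψ t) x))
      (volume.restrict (Ioo 0 T)) := by
    refine hf₂i.integral_prod_left.congr (Eventually.of_forall fun t => ?_)
    simp only [hf₂]
    exact integral_const_mul _ _
  have hc : Integrable (fun t => η t * ∫ x, s t x * ψ t x) (volume.restrict (Ioo 0 T)) := by
    refine hf₃i.integral_prod_left.congr (Eventually.of_forall fun t => ?_)
    simp only [hf₃]
    exact integral_const_mul _ _
  rw [integral_add hf₁i hf₂i, e₁, e₂, e₃] at esum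
  have esplit : ∀ t, (deriv η t * ∫ x, θ t x * ψ t x) +
      η t * ((∫ x, θ t x * (Torus.timeDeriv ψ t x + ⟪u t x, Torus.gradient (ψ t) x⟫_ℝ +
        κ * Torus.laplacian (ψ t) x)) + ∫ x, s t x * ψ t x) =
      ((deriv η t * ∫ x, θ t x * ψ t x) +
        η t * ∫ x, θ t x * (Torus.timeDeriv ψ t x + ⟪u t x, Torus.gradient (ψ t) x⟫_ℝ +
          κ * Torus.laplacian (ψ t) x)) + η t * ∫ x, s t x * ψ t x := fun t => by ring
  have hab : Integrable (fun t => (deriv η t * ∫ x, θ t x * ψ t x) +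
      η t * ∫ x, θ t x * (Torus.timeDeriv ψ t x + ⟪u t x, Torus.gradient (ψ t) x⟫_ℝ +
        κ * Torus.laplacian (ψ t) x)) (volume.restrict (Ioo 0 T)) := ha.add hb
  simp_rw [esplit]
  rw [integral_add hab hc, integral_add ha hb]
  linarith

/-- **du Bois-Reymond in time for space–time tests**: for a space–time test function `ψ` on
`[0, T)`, for a.e. `t ∈ (0,T)`,
`∫ θ(t) ψ(t) = ∫ θ₀ ψ(0) + ∫_{(0,t]} (∫ θ (∂ₜψ + u·∇ψ + κΔψ) + ∫ s ψ)`
(`setIntegral_test_smul_time` and the a.e. du Bois-Reymond lemma with datum). [folklore] -/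
theorem ae_pairing_eq_datum_add_setIntegral (h : IsWeakScalarTransportForcedOn T κ u s θ₀ θ)
    {ψ : ℝ → UnitAddTorus d → ℝ} (hψ : IsSpaceTimeTest T ψ) :
    ∀ᵐ t ∂(volume.restrict (Ioo 0 T)),
      ∫ x, θ t x * ψ t x = (∫ x, θ₀ x * ψ 0 x) +
        ∫ τ in Ioc 0 t, ((∫ x, θ τ x * (Torus.timeDeriv ψ τ x + ⟪u τ x, Torus.gradient (ψ τ) x⟫_ℝ +
          κ * Torus.laplacian (ψ τ) x)) + ∫ x, s τ x * ψ τ x) := by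
  have hU : IntegrableOn (fun t => ∫ x, θ t x * ψ t x) (Ioo 0 T) volume :=
    (integrable_mul_test h hψ).integral_prod_left
  have hF : IntegrableOn (fun t => (∫ x, θ t x * (Torus.timeDeriv ψ t x +
      ⟪u t x, Torus.gradient (ψ t) x⟫_ℝ + κ * Torus.laplacian (ψ t) x)) + ∫ x, s t x * ψ t x)
      (Ioo 0 T) volume :=
    (h.integrable_weakIntegrand hψ).integral_prod_left.add (h.integrable_source_mul_test hψ).integral_prod_left
  exact Literature.Analysis.FunctionSpaces.ae_eq_add_setIntegral_of_forall_test hU hF fun η hη hηc _ =>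
    setIntegral_test_smul_time h hη hηc hψ

/-- **The weak `L²` trace at almost every time, for every space–time test at once.** For a weak
sourced scalar, for a.e. `σ ∈ (0, T)`: `θ σ ∈ L²` and for EVERY space–time test `ψ` on `[0, T)`,
`∫ θ(σ) ψ(σ) = ∫ θ₀ ψ(0) + ∫_{(0,σ]} (∫ θ (∂ₜψ + u·∇ψ + κΔψ) + ∫ s ψ)`.
Proof: take `σ` good for `ae_forall_sliceIdentity` with `∫|θ(σ)|² ≤ C`; for a test `ψ` both
`U(t) = ∫ θ(t) ψ(t)` and the right-hand side `R(t)` converge, as `t → σ` along the full-measure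
set where the identity `U = R` and the steady identity for the slice `ψ(σ)` hold, to `U(σ)` resp.
`R(σ)`: `R` is a primitive, and
`|U(t) - U(σ)| ≤ √C ‖ψ(t) - ψ(σ)‖₂ + |∫ θ(t) ψ(σ) - ∫ θ(σ) ψ(σ)|` with the last difference equal
to an increment of the (continuous) steady right-hand side of `ψ(σ)`. [folklore] -/
theorem ae_forall_traceIdentity (h : IsWeakScalarTransportForcedOn T κ u s θ₀ θ) :
    ∀ᵐ σ ∂(volume.restrict (Ioo 0 T)), MemLp (θ σ) 2 volume ∧
      ∀ ψ : ℝ → UnitAddTorus d → ℝ, IsSpaceTimeTest T ψ →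
        ∫ x, θ σ x * ψ σ x = (∫ x, θ₀ x * ψ 0 x) +
          ∫ t in Ioc 0 σ, ((∫ x, θ t x * (Torus.timeDeriv ψ t x + ⟪u t x, Torus.gradient (ψ t) x⟫_ℝ +
            κ * Torus.laplacian (ψ t) x)) + ∫ x, s t x * ψ t x) := by
  rcases le_or_gt T 0 with hT0 | hT0
  · rw [Ioo_eq_empty_of_le hT0, Measure.restrict_empty, ae_zero]
    exact Filter.eventually_bot
  obtain ⟨C, hC⟩ := h.ae_lintegral_sq_le
  have hmeas : ∀ᵐ t ∂(volume.restrict (Ioo 0 T)), AEStronglyMeasurable (θ t) volume :=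
    h.aestronglyMeasurable_uncurry.prodMk_left
  filter_upwards [ae_forall_sliceIdentity h, hC, hmeas, ae_restrict_mem measurableSet_Ioo] with
    σ hgood hCσ hmσ hσ
  refine ⟨hgood.1, fun ψ hψ => ?_⟩
  have hφ : IsSmooth (ψ σ) := hψ.isSmooth_slice σ
  -- ### notation: the flux functional `F`, the right-hand side `R`, the steady one `mt`
  obtain ⟨F, hFeq⟩ : ∃ F : ℝ → ℝ, ∀ t, F t = (∫ x, θ t x * (Torus.timeDeriv ψ t x +
      ⟪u t x, Torus.gradient (ψ t) x⟫_ℝ + κ * Torus.laplacian (ψ t) x)) + ∫ x, s t x * ψ t x :=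
    ⟨_, fun _ => rfl⟩
  obtain ⟨R, hReq⟩ : ∃ R : ℝ → ℝ, ∀ t, R t = (∫ x, θ₀ x * ψ 0 x) + ∫ τ in Ioc 0 t, F τ :=
    ⟨_, fun _ => rfl⟩
  obtain ⟨mt, hmteq⟩ : ∃ mt : ℝ → ℝ, ∀ t, mt t = (∫ y, θ₀ y * ψ σ y) +
      ∫ τ in Ioc 0 t, ((∫ y, θ τ y * (⟪u τ y, Torus.gradient (ψ σ) y⟫_ℝ + κ * Torus.laplacian (ψ σ) y)) +
        ∫ y, s τ y * ψ σ y) := ⟨_, fun _ => rfl⟩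
  rw [show ((∫ x, θ₀ x * ψ 0 x) + ∫ t in Ioc 0 σ, ((∫ x, θ t x * (Torus.timeDeriv ψ t x +
      ⟪u t x, Torus.gradient (ψ t) x⟫_ℝ + κ * Torus.laplacian (ψ t) x)) + ∫ x, s t x * ψ t x)) = R σ by
    rw [hReq]; simp only [hFeq]]
  -- the steady identity at `σ` for the slice `ψ σ` (good time, every smooth test)
  have hmσ_eq : ∫ y, θ σ y * ψ σ y = mt σ := by rw [hmteq]; exact hgood.2 (ψ σ) hφ
  -- ### a.e. identities in `t`
  have h1 : ∀ᵐ t ∂(volume.restrict (Ioo 0 T)), ∫ x, θ t x * ψ t x = R t := by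
    filter_upwards [ae_pairing_eq_datum_add_setIntegral h hψ] with t ht
    rw [hReq, ht]; simp only [hFeq]
  have h2 : ∀ᵐ t ∂(volume.restrict (Ioo 0 T)), ∫ y, θ t y * ψ σ y = mt t := by
    filter_upwards [h.ae_integral_mul_eq hφ] with t ht
    rw [hmteq, ht]
  -- ### continuity of `R` and `mt` on `[0, T]`
  have hRc : ContinuousOn R (Icc 0 T) := by
    rw [show R = _ from funext hReq, show F = _ from funext hFeq]
    exact continuousOn_const_add_setIntegral hT0.le
      ((h.integrable_weakIntegrand hψ).integral_prod_left.add
        (h.integrable_source_mul_test hψ).integral_prod_left) _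
  have hmtc : ContinuousOn mt (Icc 0 T) := by
    rw [show mt = _ from funext hmteq]
    exact continuousOn_const_add_setIntegral hT0.le
      (((h.integrable_mul_steadyFlux hφ).integral_prod_left).add
        ((h.integrable_source_mul_continuous hφ.continuous).integral_prod_left)) _
  -- ### the time-Lipschitz bound of `ψ` on `[0, T]`, in `L²`
  obtain ⟨K, hK⟩ := exists_bound_of_continuous_uncurry hψ.continuous_uncurry_timeDeriv 0 T
  have hlip : ∀ t ∈ Icc (0 : ℝ) T, ∀ x, ‖ψ t x - ψ σ x‖ ≤ K * ‖t - σ‖ := by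
    intro t ht x
    exact (convex_Icc 0 T).norm_image_sub_le_of_norm_deriv_le (f := fun τ => ψ τ x)
      (fun τ _ => (differentiable_apply_of_contDiff_stLift hψ.1 x) τ)
      (fun τ hτ => hK τ hτ x) (Ioo_subset_Icc_self hσ) ht
  have hL2diff : ∀ t ∈ Icc (0 : ℝ) T, (eLpNorm (ψ t - ψ σ) 2 volume).toReal ≤ K * |t - σ| := by
    intro t ht
    have hKt : 0 ≤ K * |t - σ| := by
      have h0 := hlip t ht (0 : UnitAddTorus d)
      rw [Real.norm_eq_abs (t - σ)] at h0
      exact (norm_nonneg _).trans h0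
    have hle : eLpNorm (ψ t - ψ σ) 2 volume ≤ ENNReal.ofReal (K * |t - σ|) := by
      refine (eLpNorm_le_of_ae_bound (C := K * |t - σ|) (ae_of_all _ fun x => ?_)).trans ?_
      · simpa [Real.norm_eq_abs] using hlip t ht x
      · simp [measure_univ]
    exact (ENNReal.toReal_mono ENNReal.ofReal_ne_top hle).trans_eq (ENNReal.toReal_ofReal hKt)
  -- ### the good set of times for `ψ`
  set G : Set ℝ := {t | t ∈ Ioo 0 T ∧ ((∫ x, θ t x * ψ t x = R t) ∧ (∫ y, θ t y * ψ σ y = mt t) ∧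
    (∫⁻ y, ‖θ t y‖ₑ ^ 2 ≤ C) ∧ AEStronglyMeasurable (θ t) volume)} with hG
  have hσG : σ ∈ closure G := by
    apply mem_closure_of_ae_Ioo _ hσ
    filter_upwards [h1, h2, hC, hmeas] with t e1 e2 e3 e4
    exact ⟨e1, e2, e3, e4⟩
  have hGsub : G ⊆ Icc 0 T := fun t ht => Ioo_subset_Icc_self ht.1
  haveI : (𝓝[G] σ).NeBot := mem_closure_iff_nhdsWithin_neBot.1 hσG
  -- ### on `G`: `|U t - U σ| ≤ √C K |t - σ| + |mt t - mt σ|`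
  have hbound : ∀ t ∈ G, |(∫ x, θ t x * ψ t x) - ∫ x, θ σ x * ψ σ x| ≤
      Real.sqrt C * (K * |t - σ|) + |mt t - mt σ| := by
    rintro t ⟨htI, -, ht2, ht3, ht4⟩
    have hL2t : MemLp (θ t) 2 volume := memLp_two_of_lintegral_enorm_sq_le ht4 ht3
    have e : (∫ x, θ t x * ψ t x) - ∫ x, θ σ x * ψ σ x =
        (∫ x, θ t x * (ψ t x - ψ σ x)) + (mt t - mt σ) := by
      rw [← ht2, ← hmσ_eq]
      simp_rw [mul_sub]
      rw [integral_sub (integrable_mul_of_memLp_of_isSmooth hL2t (hψ.isSmooth_slice t))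
        (integrable_mul_of_memLp_of_isSmooth hL2t hφ)]
      ring
    rw [e]
    refine (abs_add_le _ _).trans (add_le_add ?_ le_rfl)
    have hH := abs_integral_mul_le_sqrt_mul_eLpNorm ht4
      (((hψ.isSmooth_slice t).memLp 2).sub (hφ.memLp 2)) ht3
    have hH' : |∫ x, θ t x * (ψ t x - ψ σ x)| ≤ Real.sqrt C * (eLpNorm (ψ t - ψ σ) 2 volume).toReal := by
      simpa only [Pi.sub_apply] using hH
    exact hH'.trans (mul_le_mul_of_nonneg_left (hL2diff t (Ioo_subset_Icc_self htI)) (Real.sqrt_nonneg _))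
  -- ### hence `U t → U σ` along `G`
  have hUlim : Tendsto (fun t => ∫ x, θ t x * ψ t x) (𝓝[G] σ) (𝓝 (∫ x, θ σ x * ψ σ x)) := by
    have hmt0 : Tendsto (fun t => |mt t - mt σ|) (𝓝[G] σ) (𝓝 0) := by
      have hc := ((hmtc.continuousWithinAt (Ioo_subset_Icc_self hσ)).mono hGsub).tendsto
      have := tendsto_iff_norm_sub_tendsto_zero.1 hc
      simpa only [Real.norm_eq_abs] using this
    have hlin : Tendsto (fun t : ℝ => Real.sqrt C * (K * |t - σ|)) (𝓝[G] σ) (𝓝 0) := by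
      have hc : Continuous fun t : ℝ => Real.sqrt C * (K * |t - σ|) := by fun_prop
      have := hc.tendsto σ
      rw [sub_self, abs_zero, mul_zero, mul_zero] at this
      exact this.mono_left nhdsWithin_le_nhds
    have hsum : Tendsto (fun t => Real.sqrt C * (K * |t - σ|) + |mt t - mt σ|) (𝓝[G] σ) (𝓝 0) := by
      simpa using hlin.add hmt0
    refine tendsto_iff_norm_sub_tendsto_zero.2 (squeeze_zero_norm' ?_ hsum)
    filter_upwards [self_mem_nhdsWithin] with t ht
    simpa only [Real.norm_eq_abs, abs_abs] using hbound t ht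
  -- ### and `R t → R σ` along `G`, where `U = R`
  have hRlim : Tendsto R (𝓝[G] σ) (𝓝 (R σ)) :=
    ((hRc.continuousWithinAt (Ioo_subset_Icc_self hσ)).mono hGsub).tendsto
  have hev : R =ᶠ[𝓝[G] σ] fun t => ∫ x, θ t x * ψ t x := by
    filter_upwards [self_mem_nhdsWithin] with t ht
    exact ht.2.1.symm
  exact tendsto_nhds_unique hUlim (hRlim.congr' hev)

/-- **The weak `L²` trace at almost every time, for every smooth space–time field.** For a weak
sourced scalar on `[0, T)`, for a.e. `σ ∈ (0, T)`: `θ σ ∈ L²` and for EVERY `ψ` with smooth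
space–time lift (no support condition),
`∫ θ(σ) ψ(σ) = ∫ θ₀ ψ(0) + ∫_{(0,σ]} (∫ θ (∂ₜψ + u·∇ψ + κΔψ) + ∫ s ψ)`
(cut `ψ` off smoothly between `(σ + T)/2` and `T` and apply `ae_forall_traceIdentity`). [folklore] -/
theorem ae_forall_traceIdentity' (h : IsWeakScalarTransportForcedOn T κ u s θ₀ θ) :
    ∀ᵐ σ ∂(volume.restrict (Ioo 0 T)), MemLp (θ σ) 2 volume ∧
      ∀ ψ : ℝ → UnitAddTorus d → ℝ, ContDiff ℝ ∞ (stLift ψ) →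
        ∫ x, θ σ x * ψ σ x = (∫ x, θ₀ x * ψ 0 x) +
          ∫ t in Ioc 0 σ, ((∫ x, θ t x * (Torus.timeDeriv ψ t x + ⟪u t x, Torus.gradient (ψ t) x⟫_ℝ +
            κ * Torus.laplacian (ψ t) x)) + ∫ x, s t x * ψ t x) := by
  filter_upwards [ae_forall_traceIdentity h, ae_restrict_mem measurableSet_Ioo] with σ hσ hσI
  refine ⟨hσ.1, fun ψ hψ => ?_⟩
  have hσa : σ < (σ + T) / 2 := by linarith [hσI.2]
  obtain ⟨ψ', hψ', heq⟩ := exists_isSpaceTimeTest_eq_of_lt (T := T) (a := (σ + T) / 2) (by linarith [hσI.2]) hψ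
  have key := hσ.2 ψ' hψ'
  rw [(heq σ hσa).1, (heq 0 (hσI.1.trans hσa)).1] at key
  rw [key]
  congr 1
  refine setIntegral_congr_fun measurableSet_Ioc fun t ht => ?_
  obtain ⟨e1, e2⟩ := heq t (ht.2.trans_lt hσa)
  rw [e1]
  simp only [e2]

end Trace

end Summit.AnomalousDissipation.AnomalousDissipation.Theorems

end
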